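import Mathlib
import Summits.Ventures.PercRepro2.Defs
import Summits.Ventures.PercRepro2.Graph
import Summits.Ventures.PercRepro2.HullDefs
import Summits.Ventures.PercRepro2.LocRows
import Summits.Ventures.PercRepro2.SwRow

/-!
# Row (SW) across the two-vertex cut `{l, h}`: the bridge lemma
(blind cell PercRepro2, night-4 g5, 2026-08-24; proofs/NIGHT4-BRIDGE.md)

Two graphs `ends₁ : E₁ → Sym2 V`, `ends₂ : E₂ → Sym2 V` on vertex sets `V₁`, `V₂` meeting exactly in
the two marks `l`, `h` are glued into `glue2 ends₁ ends₂ : E₁ ⊕ E₂ → Sym2 V`.  On the set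
`Q = {h ∉ H_l, o ∈ R_side(l)}` of row (SW) no monochromatic walk joins `l` to `h`, so every cluster of
`l` or of `h` is the UNION of its two side clusters (`cluster_glue2_l`, `cluster_glue2_h`), and `Q`
is the product of `Q(G₁; l, h, o)` with the set of second-side colourings without a monochromatic
`l`–`h` connection.  Hence row (SW) (`LocRows.Sw`, the weight-free base) composes across the cut:

* `sw_glue2` — the **bridge lemma**: for `o` on the first side, (SW)(G₁; l, h, o) ⟹ (SW)(G; l, h, o)
  with the permutation `(Φ₁, colour swap)` (the second side is swapped, which turns the red cluster of
  `h` on that side into its blue cluster exactly);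
* the path lemma and the cycles (`SwPath.lean`, next file): (SW) on a path with `l`, `h` its ends and `o`
  an interior vertex (keep the red `l`–`o` segment, swap the `o`–`h` segment unless it is all blue), hence
  by `sw_glue2` on every gluing of such a path with an arbitrary second side at `{l, h}` — the cycles
  `C_n` (two paths glued at `l`, `h`) in particular.

Together with the block reduction of night-4 g4 (`Glue.sw_all_of_noCut`) the open content of row
(SW) is the class of 2-connected multigraphs with `l`, `h` non-adjacent and `G − {l, h}` connected.
-/

namespace Summit.Ventures.PercRepro2

namespace Glue2

open Hull LocRows

open scoped Classical

variable {V : Type*} {E₁ E₂ : Type*}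

/-- The glued incidence map. -/
def glue2 (ends₁ : E₁ → Sym2 V) (ends₂ : E₂ → Sym2 V) : E₁ ⊕ E₂ → Sym2 V := Sum.elim ends₁ ends₂

/-- `{l, h}` is a two-vertex cut of the gluing: the sides meet exactly in `l` and `h` and every edge of
a side lies inside that side. -/
structure IsGluing2 (ends₁ : E₁ → Sym2 V) (ends₂ : E₂ → Sym2 V) (l h : V) (V₁ V₂ : Set V) :
    Prop where
  /-- `l` lies on the first side. -/
  l_mem₁ : l ∈ V₁
  /-- `l` lies on the second side. -/
  l_mem₂ : l ∈ V₂
  /-- `h` lies on the first side. -/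
  h_mem₁ : h ∈ V₁
  /-- `h` lies on the second side. -/
  h_mem₂ : h ∈ V₂
  /-- The sides meet only in `l` and `h`. -/
  inter : ∀ x, x ∈ V₁ → x ∈ V₂ → x = l ∨ x = h
  /-- Edges of the first side lie inside `V₁`. -/
  mem₁ : ∀ e x, x ∈ ends₁ e → x ∈ V₁
  /-- Edges of the second side lie inside `V₂`. -/
  mem₂ : ∀ e x, x ∈ ends₂ e → x ∈ V₂

variable {ends₁ : E₁ → Sym2 V} {ends₂ : E₂ → Sym2 V} {l h : V} {V₁ V₂ : Set V}

/-- The roles of `l` and `h` may be exchanged. -/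
lemma IsGluing2.symm (hg : IsGluing2 ends₁ ends₂ l h V₁ V₂) : IsGluing2 ends₁ ends₂ h l V₁ V₂ :=
  ⟨hg.h_mem₁, hg.h_mem₂, hg.l_mem₁, hg.l_mem₂, fun x h₁ h₂ => (hg.inter x h₁ h₂).symm, hg.mem₁,
    hg.mem₂⟩

/-- The blue colouring restricts to the sides. -/
lemma blue_comp_inl (ζ : Config (E₁ ⊕ E₂)) : blue ζ ∘ Sum.inl = blue (ζ ∘ Sum.inl) := rfl

/-- The blue colouring restricts to the sides. -/
lemma blue_comp_inr (ζ : Config (E₁ ⊕ E₂)) : blue ζ ∘ Sum.inr = blue (ζ ∘ Sum.inr) := rfl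

/-- An open adjacency of the glued graph comes from one of the sides. -/
lemma adj_glue2_iff {ζ : Config (E₁ ⊕ E₂)} {x y : V} :
    (openGraph (glue2 ends₁ ends₂) ζ).Adj x y ↔
      (openGraph ends₁ (ζ ∘ Sum.inl)).Adj x y ∨ (openGraph ends₂ (ζ ∘ Sum.inr)).Adj x y := by
  simp only [openGraph_adj]
  constructor
  · rintro ⟨hne, e, he, hends⟩
    rcases e with e | e
    · exact Or.inl ⟨hne, e, he, hends⟩
    · exact Or.inr ⟨hne, e, he, hends⟩
  · rintro (⟨hne, e, he, hends⟩ | ⟨hne, e, he, hends⟩)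
    · exact ⟨hne, Sum.inl e, he, hends⟩
    · exact ⟨hne, Sum.inr e, he, hends⟩

/-- A cluster of the first side stays on that side. -/
lemma cluster₁_subset (hg : IsGluing2 ends₁ ends₂ l h V₁ V₂) {ζ₁ : Config E₁} {v : V}
    (hv : v ∈ V₁) : cluster ends₁ ζ₁ v ⊆ V₁ := by
  intro u hu
  refine mem_of_conn_of_closed (ends := ends₁) (ω := ζ₁) ?_ hv hu
  intro x _ y hxy
  obtain ⟨_, e, _, hends⟩ := openGraph_adj.1 hxy
  exact hg.mem₁ e y (by rw [hends]; exact Sym2.mem_mk_right x y)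

/-- A cluster of the second side stays on that side. -/
lemma cluster₂_subset (hg : IsGluing2 ends₁ ends₂ l h V₁ V₂) {ζ₂ : Config E₂} {v : V}
    (hv : v ∈ V₂) : cluster ends₂ ζ₂ v ⊆ V₂ := by
  intro u hu
  refine mem_of_conn_of_closed (ends := ends₂) (ω := ζ₂) ?_ hv hu
  intro x _ y hxy
  obtain ⟨_, e, _, hends⟩ := openGraph_adj.1 hxy
  exact hg.mem₂ e y (by rw [hends]; exact Sym2.mem_mk_right x y)

/-- A connection on the first side is a connection of the glued graph. -/
lemma conn_glue2_of_conn₁ {ζ : Config (E₁ ⊕ E₂)} {u v : V}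
    (hc : Conn ends₁ (ζ ∘ Sum.inl) u v) : Conn (glue2 ends₁ ends₂) ζ u v := by
  have key : v ∈ cluster (glue2 ends₁ ends₂) ζ u := by
    refine mem_of_conn_of_closed (ends := ends₁) (ω := ζ ∘ Sum.inl) ?_ (mem_cluster_self _ _ _) hc
    intro x hx y hxy
    exact mem_cluster_of_adj hx (adj_glue2_iff.2 (Or.inl hxy))
  exact key

/-- A connection on the second side is a connection of the glued graph. -/
lemma conn_glue2_of_conn₂ {ζ : Config (E₁ ⊕ E₂)} {u v : V}
    (hc : Conn ends₂ (ζ ∘ Sum.inr) u v) : Conn (glue2 ends₁ ends₂) ζ u v := by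
  have key : v ∈ cluster (glue2 ends₁ ends₂) ζ u := by
    refine mem_of_conn_of_closed (ends := ends₂) (ω := ζ ∘ Sum.inr) ?_ (mem_cluster_self _ _ _) hc
    intro x hx y hxy
    exact mem_cluster_of_adj hx (adj_glue2_iff.2 (Or.inr hxy))
  exact key

/-- **The two-cut closure lemma**: if neither side connects `l` to `h`, the cluster of `l` in the glued
graph is the union of its two side clusters. -/
theorem cluster_glue2_l (hg : IsGluing2 ends₁ ends₂ l h V₁ V₂) {ζ : Config (E₁ ⊕ E₂)}
    (hh : h ∉ cluster ends₁ (ζ ∘ Sum.inl) l ∪ cluster ends₂ (ζ ∘ Sum.inr) l) :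
    cluster (glue2 ends₁ ends₂) ζ l =
      cluster ends₁ (ζ ∘ Sum.inl) l ∪ cluster ends₂ (ζ ∘ Sum.inr) l := by
  apply Set.Subset.antisymm
  · intro u hu
    refine mem_of_conn_of_closed (ends := glue2 ends₁ ends₂) (ω := ζ) ?_
      (Or.inl (mem_cluster_self _ _ _)) hu
    intro x hx y hxy
    rcases adj_glue2_iff.1 hxy with h₁ | h₂
    · -- an edge of the first side: `x ∈ V₁`
      have hxV₁ : x ∈ V₁ := by
        obtain ⟨_, e, _, hends⟩ := openGraph_adj.1 h₁
        exact hg.mem₁ e x (by rw [hends]; exact Sym2.mem_mk_left x y)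
      have hx₁ : x ∈ cluster ends₁ (ζ ∘ Sum.inl) l := by
        rcases hx with hx | hx
        · exact hx
        · have hxV₂ : x ∈ V₂ := cluster₂_subset hg hg.l_mem₂ hx
          rcases hg.inter x hxV₁ hxV₂ with hxl | hxh
          · rw [hxl]; exact mem_cluster_self _ _ _
          · exact absurd (Or.inr (hxh ▸ hx)) hh
      exact Or.inl (mem_cluster_of_adj hx₁ h₁)
    · -- an edge of the second side: `x ∈ V₂`
      have hxV₂ : x ∈ V₂ := by
        obtain ⟨_, e, _, hends⟩ := openGraph_adj.1 h₂
        exact hg.mem₂ e x (by rw [hends]; exact Sym2.mem_mk_left x y)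
      have hx₂ : x ∈ cluster ends₂ (ζ ∘ Sum.inr) l := by
        rcases hx with hx | hx
        · have hxV₁ : x ∈ V₁ := cluster₁_subset hg hg.l_mem₁ hx
          rcases hg.inter x hxV₁ hxV₂ with hxl | hxh
          · rw [hxl]; exact mem_cluster_self _ _ _
          · exact absurd (Or.inl (hxh ▸ hx)) hh
        · exact hx
      exact Or.inr (mem_cluster_of_adj hx₂ h₂)
  · rintro u (hu | hu)
    · exact conn_glue2_of_conn₁ hu
    · exact conn_glue2_of_conn₂ hu

/-- The symmetric statement for the cluster of `h`. -/
theorem cluster_glue2_h (hg : IsGluing2 ends₁ ends₂ l h V₁ V₂) {ζ : Config (E₁ ⊕ E₂)}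
    (hl : l ∉ cluster ends₁ (ζ ∘ Sum.inl) h ∪ cluster ends₂ (ζ ∘ Sum.inr) h) :
    cluster (glue2 ends₁ ends₂) ζ h =
      cluster ends₁ (ζ ∘ Sum.inl) h ∪ cluster ends₂ (ζ ∘ Sum.inr) h :=
  cluster_glue2_l hg.symm hl

/-- `u ∈ C(v) ↔ v ∈ C(u)`. -/
lemma mem_cluster_comm' {E : Type*} {ends : E → Sym2 V} {ω : Config E} {u v : V} :
    u ∈ cluster ends ω v ↔ v ∈ cluster ends ω u := by
  simp only [mem_cluster]; exact ⟨conn_symm, conn_symm⟩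

/-- `h` is in the cluster of `l` in the glued graph iff it is on one of the sides. -/
theorem h_mem_cluster_glue2_iff (hg : IsGluing2 ends₁ ends₂ l h V₁ V₂) {ζ : Config (E₁ ⊕ E₂)} :
    h ∈ cluster (glue2 ends₁ ends₂) ζ l ↔
      h ∈ cluster ends₁ (ζ ∘ Sum.inl) l ∨ h ∈ cluster ends₂ (ζ ∘ Sum.inr) l := by
  constructor
  · intro hmem
    by_contra hcon
    rw [cluster_glue2_l hg hcon] at hmem
    exact hcon hmem
  · rintro (hc | hc)
    · exact conn_glue2_of_conn₁ hc
    · exact conn_glue2_of_conn₂ hc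

/-- A vertex of the first side other than `l`, `h` lies in the cluster of `l` iff it does so on the
first side (when `h` is in no side cluster of `l`). -/
theorem mem_cluster_glue2_iff (hg : IsGluing2 ends₁ ends₂ l h V₁ V₂) {ζ : Config (E₁ ⊕ E₂)}
    {o : V} (ho : o ∈ V₁) (hol : o ≠ l) (hoh : o ≠ h)
    (hh : h ∉ cluster ends₁ (ζ ∘ Sum.inl) l ∪ cluster ends₂ (ζ ∘ Sum.inr) l) :
    o ∈ cluster (glue2 ends₁ ends₂) ζ l ↔ o ∈ cluster ends₁ (ζ ∘ Sum.inl) l := by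
  rw [cluster_glue2_l hg hh]
  constructor
  · rintro (h₁ | h₂)
    · exact h₁
    · have hoV₂ : o ∈ V₂ := cluster₂_subset hg hg.l_mem₂ h₂
      rcases hg.inter o ho hoV₂ with h' | h'
      · exact absurd h' hol
      · exact absurd h' hoh
  · exact Or.inl

/-! ## The product structure of `Q` -/

/-- The second-side colourings without a monochromatic `l`–`h` connection. -/
def NoMono (ends₂ : E₂ → Sym2 V) (l h : V) (ζ₂ : Config E₂) : Prop :=
  h ∉ cluster ends₂ ζ₂ l ∧ h ∉ cluster ends₂ (blue ζ₂) l

/-- `NoMono` is invariant under the colour swap. -/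
lemma noMono_blue {ζ₂ : Config E₂} (hn : NoMono ends₂ l h ζ₂) : NoMono ends₂ l h (blue ζ₂) := by
  refine ⟨hn.2, ?_⟩
  rw [blue_blue]; exact hn.1

/-- The configuration of the glued graph with the given sides. -/
def pair2 (ζ₁ : Config E₁) (ζ₂ : Config E₂) : Config (E₁ ⊕ E₂) := Sum.elim ζ₁ ζ₂

/-- The first side of a pair. -/
lemma pair2_inl (ζ₁ : Config E₁) (ζ₂ : Config E₂) : pair2 ζ₁ ζ₂ ∘ Sum.inl = ζ₁ := rfl

/-- The second side of a pair. -/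
lemma pair2_inr (ζ₁ : Config E₁) (ζ₂ : Config E₂) : pair2 ζ₁ ζ₂ ∘ Sum.inr = ζ₂ := rfl

/-- A configuration is the pair of its sides. -/
lemma pair2_sides (ζ : Config (E₁ ⊕ E₂)) : pair2 (ζ ∘ Sum.inl) (ζ ∘ Sum.inr) = ζ := by
  funext e; rcases e with e | e <;> rfl

/-- If `h` is not in the cluster of `l`, the cluster of `h` is the union of its side clusters. -/
lemma cluster_h_of_not_mem (hg : IsGluing2 ends₁ ends₂ l h V₁ V₂) {ζ : Config (E₁ ⊕ E₂)}
    (hζ : h ∉ cluster (glue2 ends₁ ends₂) ζ l) :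
    cluster (glue2 ends₁ ends₂) ζ h =
      cluster ends₁ (ζ ∘ Sum.inl) h ∪ cluster ends₂ (ζ ∘ Sum.inr) h := by
  apply cluster_glue2_h hg
  have hA := (h_mem_cluster_glue2_iff hg).not.1 hζ
  rw [not_or] at hA
  rintro (hc | hc)
  · exact hA.1 (mem_cluster_comm'.1 hc)
  · exact hA.2 (mem_cluster_comm'.1 hc)

variable [Fintype E₁] [DecidableEq E₁] [Fintype E₂] [DecidableEq E₂]

/-- **`Q` of the glued graph is a product**: a colouring lies in `Q(G; l, h, o)` iff its first side lies
in `Q(G₁; l, h, o)` and its second side has no monochromatic `l`–`h` connection. -/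
theorem mem_tgtU_glue2_iff (hg : IsGluing2 ends₁ ends₂ l h V₁ V₂) {o : V} (ho : o ∈ V₁) (hol : o ≠ l)
    (hoh : o ≠ h) {ζ : Config (E₁ ⊕ E₂)} :
    ζ ∈ tgtU (glue2 ends₁ ends₂) l h {S : Set V | o ∈ S} ↔
      (ζ ∘ Sum.inl) ∈ tgtU ends₁ l h {S : Set V | o ∈ S} ∧ NoMono ends₂ l h (ζ ∘ Sum.inr) := by
  simp only [tgtU, Finset.mem_filter, Finset.mem_univ, true_and, hull, Set.mem_union,
    Set.mem_setOf_eq, NoMono, not_or]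
  constructor
  · rintro ⟨⟨hA, hB⟩, hoA, hoB⟩
    have hA' := (h_mem_cluster_glue2_iff hg).not.1 hA
    have hB' := (h_mem_cluster_glue2_iff hg (ζ := blue ζ)).not.1 hB
    rw [not_or] at hA' hB'
    rw [blue_comp_inl, blue_comp_inr] at hB'
    refine ⟨⟨⟨hA'.1, hB'.1⟩, ?_, ?_⟩, hA'.2, hB'.2⟩
    · rw [mem_cluster_glue2_iff hg ho hol hoh (Or.elim · hA'.1 hA'.2)] at hoA
      exact hoA
    · intro hcon
      apply hoB
      rw [mem_cluster_glue2_iff hg ho hol hoh (blue_comp_inl ζ ▸ blue_comp_inr ζ ▸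
        (Or.elim · hB'.1 hB'.2))]
      rw [blue_comp_inl]; exact hcon
  · rintro ⟨⟨⟨hA₁, hB₁⟩, hoA₁, hoB₁⟩, hA₂, hB₂⟩
    have hA : h ∉ cluster ends₁ (ζ ∘ Sum.inl) l ∪ cluster ends₂ (ζ ∘ Sum.inr) l :=
      fun hc => hc.elim hA₁ hA₂
    have hB : h ∉ cluster ends₁ (blue ζ ∘ Sum.inl) l ∪ cluster ends₂ (blue ζ ∘ Sum.inr) l := by
      rw [blue_comp_inl, blue_comp_inr]; exact fun hc => hc.elim hB₁ hB₂
    refine ⟨⟨?_, ?_⟩, ?_, ?_⟩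
    · exact (h_mem_cluster_glue2_iff hg).not.2 hA
    · exact (h_mem_cluster_glue2_iff hg (ζ := blue ζ)).not.2 hB
    · exact (mem_cluster_glue2_iff hg ho hol hoh hA).2 hoA₁
    · rw [mem_cluster_glue2_iff hg ho hol hoh hB, blue_comp_inl]; exact hoB₁

/-- The two hull conditions of `Q`. -/
lemma not_mem_of_mem_tgtU {E : Type*} [Fintype E] [DecidableEq E] {ends : E → Sym2 V} {o : V}
    {ζ : Config E} (hζ : ζ ∈ tgtU ends l h {S : Set V | o ∈ S}) :
    h ∉ cluster ends ζ l ∧ h ∉ cluster ends (blue ζ) l := by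
  simp only [tgtU, Finset.mem_filter, Finset.mem_univ, true_and, hull, Set.mem_union,
    Set.mem_setOf_eq, not_or] at hζ
  exact hζ.1

/-- **The bridge lemma**: row (SW) on the first side gives row (SW) on the glued graph, for `o` on the
first side.  The permutation is `(Φ₁, colour swap)`. -/
theorem sw_glue2 (hg : IsGluing2 ends₁ ends₂ l h V₁ V₂) {o : V} (ho : o ∈ V₁) (hol : o ≠ l)
    (hoh : o ≠ h) (hs : Sw ends₁ l h o) : Sw (glue2 ends₁ ends₂) l h o := by
  obtain ⟨f, hf, hmem⟩ := hs
  refine ⟨fun x => pair2 (f ⟨x.1 ∘ Sum.inl, ((mem_tgtU_glue2_iff hg ho hol hoh).1 x.2).1⟩)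
    (blue (x.1 ∘ Sum.inr)), ?_, ?_⟩
  · -- injectivity: both sides are recovered
    intro x y hxy
    have h₁ : f ⟨x.1 ∘ Sum.inl, ((mem_tgtU_glue2_iff hg ho hol hoh).1 x.2).1⟩ =
        f ⟨y.1 ∘ Sum.inl, ((mem_tgtU_glue2_iff hg ho hol hoh).1 y.2).1⟩ := by
      have := congrArg (fun ζ => ζ ∘ Sum.inl) hxy
      simpa [pair2_inl] using this
    have h₂ : blue (x.1 ∘ Sum.inr) = blue (y.1 ∘ Sum.inr) := by
      have := congrArg (fun ζ => ζ ∘ Sum.inr) hxy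
      simpa [pair2_inr] using this
    have e₁ : x.1 ∘ Sum.inl = y.1 ∘ Sum.inl := congrArg Subtype.val (hf h₁)
    have e₂ : x.1 ∘ Sum.inr = y.1 ∘ Sum.inr := by
      have := congrArg blue h₂
      simpa [blue_blue] using this
    apply Subtype.ext
    rw [← pair2_sides x.1, ← pair2_sides y.1, e₁, e₂]
  · intro x
    obtain ⟨hx₁, hx₂⟩ := (mem_tgtU_glue2_iff hg ho hol hoh).1 x.2
    obtain ⟨hft, hsub⟩ := hmem ⟨x.1 ∘ Sum.inl, hx₁⟩
    have himg : pair2 (f ⟨x.1 ∘ Sum.inl, hx₁⟩) (blue (x.1 ∘ Sum.inr)) ∈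
        tgtU (glue2 ends₁ ends₂) l h {S : Set V | o ∈ S} := by
      rw [mem_tgtU_glue2_iff hg ho hol hoh, pair2_inl, pair2_inr]
      exact ⟨hft, noMono_blue hx₂⟩
    refine ⟨himg, ?_⟩
    -- domination: side by side
    rw [cluster_h_of_not_mem hg (not_mem_of_mem_tgtU x.2).1,
      cluster_h_of_not_mem hg (not_mem_of_mem_tgtU himg).2]
    rw [blue_comp_inl, blue_comp_inr, pair2_inl, pair2_inr, blue_blue]
    exact Set.union_subset_union hsub le_rfl

end Glue2

end Summit.Ventures.PercRepro2
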